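import Literature.NumberTheory.Automorphic.Sweep1PotentialModularity
import Literature.NumberTheory.Automorphic.ReciprocityGLn
import HarnessLib

/-!
# Potential modularity of elliptic curves over CM fields with soluble descent (lang.S28, strong
form): Allen et al., Cor. 7.1.12 and Prop. 6.5.13

Sibling file of `Literature.NumberTheory.Automorphic.Sweep1PotentialModularity` (the Galois form of
lang.S28 — Allen–Calegari–Caraiani–Gee–Helm–Le Hung–Newton–Scholze–Taylor–Thorne, *Potential
automorphy over CM fields*, Ann. of Math. 197 (2023), Cor. 7.1.12 for `m = 1` and the compatible
system `R_E` of a non-CM elliptic curve over a CM field `F`: `R_E` becomes automorphic over a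
finite Galois CM extension `F'/F` — read as `WeierstrassCurve.IsTateAutomorphic`; its former named
fact `exists_isCMField_isTateAutomorphic` was merged back into the parent obligation
`exists_isCMField_isModular` by the review of 2026-08-15, D-0026, and is spelled out below).
This file vendors the **strong form with soluble descent** requested by the route
`Summits/Langlands/Langlands/Theses/AnalyticDescent` (support item `StrongPotentialModularityEC`):
`F'` can be taken so that `R_E|_{G_K}` is automorphic for **every** intermediate field
`F ⊆ K ⊆ F'` with `Gal(F'/K)` soluble (in particular for `K = F'`), and it states automorphy on
both automorphic carriers of the tree:

* `WeierstrassCurve.HasTateFrobPolyAt W v a` (**definition**, the Galois side, condition (5a) of a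
  very weakly compatible system at `v` for `R_E`): for every prime `ℓ` with `v ∤ ℓ` (and every
  continuity / finiteness witness of `V_ℓ E`), the rational Tate module
  `V_ℓ E = rationalTateGaloisRepOf (geomPoints W) ℓ h` is unramified at `v` and every arithmetic
  Frobenius at `v` has characteristic polynomial `X² - a X + q_v` — *verbatim* the Galois clause
  of the sibling's `WeierstrassCurve.IsTateAutomorphic` (`hasTateFrobPolyAt_iff` is `Iff.rfl`).
* `WeierstrassCurve.IsCuspidalTateAutomorphic W` (**definition**): "`R_E` is automorphic" (source
  §7.1) read on the carrier `CuspidalAutomorphicRepData 2 K hK` of `AutomorphicRepsGL` /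
  `ReciprocityGLn` (the carrier of the accepted lang.S03, lang.S27, lang.S28
  `potentiallyModular_ellipticCurve_CM` and of the summit `Langlands`), in the three Satake
  normalisations in use in the tree (see "Normalisations"): the printed weight-zero `π`
  (`HasWeightZero`, `∏_{z ∈ α} (X - q_v^{1/2} z) = X² - a X + q_v`), its L-algebraic twist
  `π_H = π ⊗ |det|^{-1/2}` (`IsLAlgebraic`, `∏ (X - z) = X² - a X + q_v`: Satake parameter = the
  eigenvalues of the geometric Frobenius on `H¹ = V_ℓ(E)^∨`) and `π_V = π ⊗ |det|^{1/2}`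
  (`IsLAlgebraic`, `∏ (X - z⁻¹) = X² - a X + q_v`: inverse Satake parameter = the eigenvalues of the
  arithmetic Frobenius on `V_ℓ E`, i.e. Buzzard–Gee's `m = 1` dictionary `arithFrobPolyOfSatake ι q_v 1`
  of `ReciprocityGLn` for `ρ = V_ℓ E`), with the Galois side `HasTateFrobPolyAt W v a` for the
  same `a`, at all but finitely many `v`.
* `exists_isCMField_forall_isSolvable_isTateAutomorphic` (**named fact**, the strong form): for an
  elliptic curve `E` without geometric CM over a CM field `F` there is a finite Galois extension
  `F'/F` with `F'` CM such that for every intermediate field `K` (`IsScalarTower F K F'`) with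
  `Gal(F'/K)` soluble, `E ×_F K` is Tate-automorphic (sibling's `IsTateAutomorphic`, `L²` carrier)
  and cuspidal-Tate-automorphic (`IsCuspidalTateAutomorphic`).
* Proved API: `exists_isCMField_isTateAutomorphic_of_forall_isSolvable` (the strong form implies
  the Galois form of lang.S28: `K = F'`, `Gal(F'/F')` trivial); the Galois halves
  `IsCuspidalTateAutomorphic.eventually_hasTateFrobPolyAt`,
  `HasTateFrobPolyAt.isUnramifiedAt`/`.hasFrobCharpolyAt`; the route-ready forms
  `IsCuspidalTateAutomorphic.exists_isLAlgebraic_arithFrobPolyOfSatake` (for every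
  `ι : ℚ̄_ℓ ≃+* ℂ` an L-algebraic cuspidal `π` with `arithFrobPolyOfSatake ι q_v 1 γ = X² - a X + q_v`
  in `ℚ̄_ℓ[X]` and `HasTateFrobPolyAt W v a`, a.e. `v` — the shape of the summit's
  `SatakeFrobCompatibleAt` for `ρ = V_ℓ E ⊗ ℚ̄_ℓ`) and `.exists_isLAlgebraic_prod_X_sub_C` (the `π_H`
  form mapped into `ℚ̄_ℓ[X]`); polynomial helpers `map_prod_X_sub_C_inv`, `map_prod_X_sub_C`,
  `map_map_frobPoly`.

## Source (read: arXiv 1812.09999v2 = the Annals text, held as `paper:arxiv-1812.09999`; the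
held chunks number the results 124/140/141, the printed numbers are 6.5.13/7.1.11/7.1.12)

* §7.1 (definition): *The very weakly compatible system `R` is defined to be automorphic if there
  is a regular algebraic, cuspidal automorphic representation `π` of `GL_n(𝔸_F)` and an embedding
  `ı : M ↪ ℂ`, such that if `v ∉ S`, then `π_v` is unramified and `rec(π_v |det|_v^{(1-n)/2})(Frob_v)`
  has characteristic polynomial `ı(Q_v(X))`.* (`Frob_v` geometric, `Art` sends uniformizers to
  geometric Frobenii, §1.) *Strongly irreducible*: `R|_{G_{F'}}` irreducible for every finite `F'/F`.
* **Cor. 7.1.12**: *Suppose that `F` is a CM field and that the 5-tuple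
  `R = (M, S, {Q_v(X)}, {r_λ}, {{0,1}})` is a strongly irreducible rank 2 very weakly compatible
  system of `l`-adic representations of `G_F`. If `m` is a non-negative integer, then there exists
  a finite Galois CM extension `F'/F` such that the weakly compatible system `Symm^m R|_{G_{F'}}` is
  automorphic.* (Immediate from Thm. 7.1.11, which gives a finite CM Galois `F^suffices/F` and
  automorphy of `Symm^{m_i} R_i|_{G_{F'}}` for every finite CM `F' ⊇ F^suffices` unramified above
  `𝓛` and linearly disjoint from `F^avoid`.)
* **Prop. 6.5.13 (2)** (soluble descent): *Fix `n ≥ 2`, a prime `p`, `ι : ℚ̄_p ≅ ℂ`. Let `F` be an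
  imaginary CM or totally real number field, and let `E/F` be a finite Galois extension such that
  `Gal(E/F)` is soluble and `E` is also imaginary CM or totally real. Let `ρ : G_F → GL_n(ℚ̄_p)` be a
  continuous representation such that `ρ|_{G_E}` is irreducible. Suppose that there exists a
  cuspidal, regular algebraic automorphic representation `π` of `GL_n(𝔸_E)` of weight `λ` such that
  `ρ|_{G_E} ≅ r_ι(π)`. … Then … there exists a cuspidal, regular algebraic automorphic representation
  `π_F` of `GL_n(𝔸_F)` of weight `λ_F` such that `ρ ≅ r_ι(π_F)`.* Its printed proof: induction to
  `E/F` cyclic of prime degree; `π^σ ≅ π` by strong multiplicity one; cyclic descent and strong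
  lifting of Arthur–Clozel (*Simple algebras, base change, …*, Ch. 3, Thm. 4.2 (d) and Thm. 5.1,
  held, read); Chebotarev; the twist `Π ⊗ (η ∘ Art_F⁻¹)^i` selected through `r_ι` (the Galois
  representations of Harris–Lan–Taylor–Thorne, Thm. A, for regular algebraic cuspidal `π` over CM
  fields).
* **The strong form** (how the named fact follows from the printed results). Let `E/F` be non-CM,
  `F` CM. `R_E = (ℚ, S_E, {X² - a_v X + q_v}, {r_{E,l} = H¹_ét(E_{F̄}, ℚ̄_l) = V_l(E)^∨}, {{0,1}})` is a
  strongly irreducible rank-2 very weakly compatible system (as used by the source for Thm. 1.0.1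
  and Cor. 7.1.14; irreducibility over every number field: Serre, Invent. Math. 15 (1972), §4.4–4.5
  (open image for non-CM `E`), or Faltings 1983, §5 Satz 4 with `End_{F'}(E) = ℤ`). Cor. 7.1.12
  (`m = 1`) gives a finite Galois CM `F'/F` and a regular algebraic cuspidal `π'` of `GL_2(𝔸_{F'})`
  (of weight `0`, `H_τ = {0,1}`) realising `R_E|_{G_{F'}}`; by HLTT Thm. A and Chebotarev /
  Brauer–Nesbitt, `r_ι(π') ≅ r_{E,p}|_{G_{F'}}`. For an intermediate field `F ⊆ K ⊆ F'` with
  `Gal(F'/K)` soluble: `K` is CM (a subfield of the CM field `F'` containing the totally imaginary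
  `F`: complex conjugation is central in the Galois closure, so it preserves `K` and is non-trivial
  on it), `F'/K` is Galois and soluble, `r_{E,p}|_{G_{F'}}` is irreducible, so Prop. 6.5.13 (2) over
  `K` gives a cuspidal regular algebraic `π_K` of `GL_2(𝔸_K)` of weight `0` with
  `r_ι(π_K) ≅ r_{E,p}|_{G_K}`, and HLTT Thm. A at the unramified places of `π_K` gives
  "`R_E|_{G_K}` is automorphic" at all but finitely many places. Cf. Barnet-Lamb–Gee–Geraghty–
  Taylor 2014, §5.4 (proof of Thm. 5.4.1: the same passage to soluble-index subfields in the
  polarised setting, via BLGHT Lemma 1.4).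

## Normalisations (three readings of one printed sentence; cf. the sibling's module docstring)

Write `Q_v = X² - a_v X + q_v = (X - μ₁)(X - μ₂)` (`μ₁ μ₂ = q_v`). The printed `π` is unitary at
`v`: `rec(π_v)(Frob_v)` has eigenvalues `μ_j q_v^{-1/2}`, which in the tree's unitary Satake
normalisation (`HasSatakeParamAt`: `T_{v,i}`-eigenvalues `q_v^{i(n-i)/2} e_i(α)`, `rec(π_v) =
⊕ χ_j ∘ Art⁻¹`, `α_j = χ_j(ϖ_v)`) is `α = {μ_j / √q_v}`: `∏ (X - √q_v z) = Q_v`, as in the sibling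
and in `potentiallyModular_ellipticCurve_CM` (`√q_v (α₁ + α₂) = a_v`). `π` has weight `0`
(`HasWeightZero`; Clozel: regular algebraic = C-algebraic and regular). Twisting by `|det|^{∓1/2}`
multiplies Satake parameters by `|ϖ_v|^{∓1/2} = q_v^{±1/2}` and turns C-algebraic into L-algebraic
(Buzzard–Gee 2014, Def. 3.1.1 and §3.4: *"`π` is L-algebraic iff `π ⊗ |det|^{(n-1)/2}` is
C-algebraic"*; §8.1: Clozel's conjectures are BG's for `π ⊗ |·|^{(n-1)/2}`): `π_H = π ⊗ |det|^{-1/2}`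
has `β = {μ_j}` (`∏ (X - z) = Q_v`; `rec(π_{H,v})(Frob_v)` = geometric Frobenius on `H¹ = V^∨`, the
printed condition itself), and `π_V = π ⊗ |det|^{1/2} = π_H ⊗ |det|` has `γ = {μ_j / q_v} =
{μ₂⁻¹, μ₁⁻¹}` (`∏ (X - z⁻¹) = Q_v`; so `∏ (X - ι⁻¹(γ_j⁻¹)) = Q_v = det(X - σ_v | V_ℓ E)` for the
arithmetic Frobenius `σ_v`, the clause `arithFrobPolyOfSatake ι q_v 1 γ` of the summit's
`SatakeFrobCompatibleAt` for `ρ = V_ℓ E`; and `∏ (X - γ_j) = X² - (a_v/q_v) X + 1/q_v =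
det(X - σ_v | V_ℓ(E)^∨)`). The tree has no twist of `CuspidalAutomorphicRepData` by `|det|^s`
(`AutomorphicTwistBJ` twists by finite-order characters only), so the three representations are
stated side by side rather than derived from one another.

*What is dropped (weaker than the source, never stronger):* "for all `v ∉ S_E`" becomes "for all
but finitely many `v`"; regular algebraicity is asserted only as `HasWeightZero` for `π` and
`IsLAlgebraic` for `π_H`, `π_V`; the identity `r_ι(π_K) ≅ r_{E,p}|_{G_K}` of Prop. 6.5.13 is
recorded only through its unramified a.e. consequence (the tree's `R_E` lives over `ℚ_ℓ`, not
`ℚ̄_ℓ`; the framed `ℚ̄_ℓ`-form is the pending definition `framedTateGaloisRep` of the route).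

## Design notes

* New leaf file: it imports the sibling (for `IsTateAutomorphic`, `frobPoly`) and
  `ReciprocityGLn` (for `CuspidalAutomorphicRepData`, `IsLAlgebraic`, `HasWeightZero`,
  `arithFrobPolyOfSatake`, `PadicAlgCl`); no import cycle is possible (nothing imports this file).
* Intermediate fields are typed exactly as in the route's `DescentGL2`:
  `(K : Type) [Field K] [NumberField K] [Algebra F K] [Algebra K F'] [IsScalarTower F K F']`,
  `IsSolvable (F' ≃ₐ[K] F')`; `K = F'` is allowed (`Algebra.id`, `IsScalarTower.right`,
  `AlgEquiv.subsingleton_left`, `isSolvable_of_subsingleton`), which is how the sibling's fact is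
  recovered. `F'/K` is automatically Galois (Mathlib `IsGalois.tower_top_of_isGalois`), not restated.
* `hK : isCompact_glFiniteIntegralLevel 2 K` (a true named fact needed to *type* `π`) sits inside
  the existential, as in `potentiallyModular_ellipticCurve_CM`.
* The continuity and finiteness witnesses of `V_ℓ E` are universally quantified inside
  `HasTateFrobPolyAt` (they are the named facts `continuous_rationalGaloisRepTate`,
  `module_finite_rationalTateModule` of `TateModule`), exactly as in the sibling.
* Mathlib (grepped): `PadicAlgCl`, `IsSolvable`, `isSolvable_of_subsingleton`,
  `AlgEquiv.subsingleton_left`, `IsScalarTower.right`, `Polynomial.map_multiset_prod`,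
  `Polynomial.map_map`, `RingHom.ext_int`, `NumberField.IsCMField`, `IsGalois`. Mathlib has no
  automorphic representations and no modularity statement.
* No new instances; no `sorry`.

## References

* P. B. Allen, F. Calegari, A. Caraiani, T. Gee, D. Helm, B. V. Le Hung, J. Newton, P. Scholze,
  R. Taylor, J. A. Thorne, *Potential automorphy over CM fields*, Ann. of Math. (2) 197 (2023),
  897–1113 (arXiv:1812.09999v2): §1, §7.1, Thm. 7.1.11, Cor. 7.1.12, Cor. 7.1.14, Prop. 6.5.13.
  [AllenCalegariCaraianiGeeEtAl2023]
* J. Arthur, L. Clozel, *Simple algebras, base change, and the advanced theory of the trace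
  formula*, Ann. of Math. Stud. 120 (1989), Ch. 3, Thm. 4.2 and Thm. 5.1. [ArthurClozelAMS120]
* M. Harris, K.-W. Lan, R. Taylor, J. Thorne, *On the rigid cohomology of certain Shimura
  varieties*, Res. Math. Sci. 3 (2016), Thm. A. [HarrisLanTaylorThorneRMS2016]
* K. Buzzard, T. Gee, *The conjectural connections between automorphic representations and Galois
  representations*, LMS Lecture Note Ser. 414 (2014), Def. 3.1.1, §3.4, §8.1. [BuzzardGeeLMS2014]
* T. Barnet-Lamb, T. Gee, D. Geraghty, R. Taylor, *Potential automorphy and change of weight*,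
  Ann. of Math. 179 (2014), §5.4. [BarnetlambEtAl2014]
* J.-P. Serre, *Propriétés galoisiennes des points d'ordre fini des courbes elliptiques*, Invent.
  Math. 15 (1972), §4.4–4.5. [SerreInventiones1972]
-/

noncomputable section

open scoped MatrixGroups Polynomial NumberField
open NumberField IsDedekindDomain MeasureTheory Filter Polynomial

namespace Literature.NumberTheory.Automorphic

/-! ### Polynomial helpers: transporting the Satake identities along `ι⁻¹ : ℂ → ℚ̄_ℓ` -/

section PolyHelpers

variable {R S : Type*} [Field R] [Field S]

/-- `(∏_{z ∈ γ} (X - z⁻¹)).map f = ∏_{z ∈ γ} (X - f(z)⁻¹)` for a ring homomorphism of fields `f`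
(Mathlib `Polynomial.map_multiset_prod`, `map_inv₀`). [folklore] -/
theorem map_prod_X_sub_C_inv (f : R →+* S) (γ : Multiset R) :
    ((γ.map fun z => (X : R[X]) - C z⁻¹).prod).map f =
      (γ.map fun z => (X : S[X]) - C (f z)⁻¹).prod := by
  rw [Polynomial.map_multiset_prod, Multiset.map_map]
  congr 1
  refine Multiset.map_congr rfl fun z _ => ?_
  simp [Polynomial.map_sub, map_inv₀]

/-- `(∏_{z ∈ β} (X - z)).map f = ∏_{z ∈ β} (X - f z)` (Mathlib `Polynomial.map_multiset_prod`).
[folklore] -/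
theorem map_prod_X_sub_C (f : R →+* S) (β : Multiset R) :
    ((β.map fun z => (X : R[X]) - C z).prod).map f =
      (β.map fun z => (X : S[X]) - C (f z)).prod := by
  rw [Polynomial.map_multiset_prod, Multiset.map_map]
  congr 1
  refine Multiset.map_congr rfl fun z _ => ?_
  simp [Polynomial.map_sub]

omit [Field R] [Field S] in
/-- `((X² - a X + q).map (ℤ → R)).map f = (X² - a X + q).map (ℤ → S)`: integral polynomials are
fixed by every ring homomorphism (Mathlib `Polynomial.map_map`, `RingHom.ext_int`). [folklore] -/
theorem map_map_frobPoly {R S : Type*} [CommRing R] [CommRing S] (f : R →+* S) (a : ℤ) (q : ℕ) :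
    ((frobPoly a q).map (Int.castRingHom R)).map f = (frobPoly a q).map (Int.castRingHom S) := by
  rw [Polynomial.map_map, RingHom.ext_int (f.comp (Int.castRingHom R)) (Int.castRingHom S)]

end PolyHelpers

/-! ### The Galois side: Frobenius polynomials of the Tate modules of `E` -/

section TateFrobPoly

/-- **`V_ℓ E` has Frobenius polynomial `X² - a X + q_v` at `v`** (condition (5a) of a very weakly
compatible system, source §7.1, for `R_E` at the place `v`, on the tree's objects): for every
prime `ℓ` with `v ∤ ℓ` and all witnesses `h` (joint continuity) and `_` (finite dimension) of the
rational Tate module `V_ℓ E` — the named facts `continuous_rationalGaloisRepTate`,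
`module_finite_rationalTateModule` of `TateModule`, arguments rather than instances — the Galois
representation `V_ℓ E = rationalTateGaloisRepOf (geomPoints W) ℓ h` (`HasseWeilAbelian`) is
unramified at `v` and every arithmetic Frobenius at `v` has characteristic polynomial
`X² - a X + q_v` on it (`GaloisRep.IsUnramifiedAt`, `GaloisRep.HasFrobCharpolyAt` of `GaloisRep`;
`det(X - σ_v | V_ℓ E)` for the arithmetic `σ_v` equals `det(X - Frob_v | V_ℓ(E)^∨)` for the
geometric `Frob_v`, the printed `Q_v`). Verbatim the Galois clause of the sibling's
`WeierstrassCurve.IsTateAutomorphic` (`hasTateFrobPolyAt_iff`). At a place of good reduction this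
holds with `a = a_v(E) = q_v + 1 - #Ẽ(k_v)` (Silverman V.2.3.1, VII.4.1), which is not asserted
here. Deliberate dot-notation extension of Mathlib's `WeierstrassCurve` namespace, as
`IsTateAutomorphic`. [cite: AllenCalegariCaraianiGeeEtAl2023, §7.1 (condition (5a), for R = R_E)] -/
def _root_.WeierstrassCurve.HasTateFrobPolyAt {K : Type} [Field K] [NumberField K]
    (W : WeierstrassCurve K) (v : HeightOneSpectrum (𝓞 K)) (a : ℤ) : Prop :=
  ∀ (ℓ : ℕ) [Fact ℓ.Prime], (ℓ : 𝓞 K) ∉ v.asIdeal →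
    ∀ (h : Continuous fun x : Field.absoluteGaloisGroup K × W.rationalTateModule ℓ =>
        EllipticCurves.rationalTateRepresentation (Field.absoluteGaloisGroup K)
          (WeierstrassCurve.geomPoints W) ℓ x.1 x.2)
      (_ : Module.Finite ℚ_[ℓ] (W.rationalTateModule ℓ)),
      (EllipticCurves.rationalTateGaloisRepOf (WeierstrassCurve.geomPoints W) ℓ h).IsUnramifiedAt v ∧
      (EllipticCurves.rationalTateGaloisRepOf (WeierstrassCurve.geomPoints W) ℓ h).HasFrobCharpolyAt v
        ((frobPoly a v.residueCard).map (Int.castRingHom ℚ_[ℓ]))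

/-- Unfolding `HasTateFrobPolyAt` (it is literally the Galois clause of `IsTateAutomorphic`).
[folklore] -/
theorem _root_.WeierstrassCurve.hasTateFrobPolyAt_iff {K : Type} [Field K] [NumberField K]
    (W : WeierstrassCurve K) (v : HeightOneSpectrum (𝓞 K)) (a : ℤ) :
    W.HasTateFrobPolyAt v a ↔
      ∀ (ℓ : ℕ) [Fact ℓ.Prime], (ℓ : 𝓞 K) ∉ v.asIdeal →
        ∀ (h : Continuous fun x : Field.absoluteGaloisGroup K × W.rationalTateModule ℓ =>
            EllipticCurves.rationalTateRepresentation (Field.absoluteGaloisGroup K)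
              (WeierstrassCurve.geomPoints W) ℓ x.1 x.2)
          (_ : Module.Finite ℚ_[ℓ] (W.rationalTateModule ℓ)),
          (EllipticCurves.rationalTateGaloisRepOf (WeierstrassCurve.geomPoints W) ℓ h).IsUnramifiedAt v ∧
          (EllipticCurves.rationalTateGaloisRepOf (WeierstrassCurve.geomPoints W) ℓ h).HasFrobCharpolyAt v
            ((frobPoly a v.residueCard).map (Int.castRingHom ℚ_[ℓ])) :=
  Iff.rfl

/-- The unramified half of `HasTateFrobPolyAt` at a fixed prime `ℓ` with `v ∤ ℓ`. [folklore] -/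
theorem _root_.WeierstrassCurve.HasTateFrobPolyAt.isUnramifiedAt {K : Type} [Field K]
    [NumberField K] {W : WeierstrassCurve K} {v : HeightOneSpectrum (𝓞 K)} {a : ℤ}
    (hW : W.HasTateFrobPolyAt v a) (ℓ : ℕ) [Fact ℓ.Prime] (hℓ : (ℓ : 𝓞 K) ∉ v.asIdeal)
    (h : Continuous fun x : Field.absoluteGaloisGroup K × W.rationalTateModule ℓ =>
      EllipticCurves.rationalTateRepresentation (Field.absoluteGaloisGroup K)
        (WeierstrassCurve.geomPoints W) ℓ x.1 x.2)
    (hfin : Module.Finite ℚ_[ℓ] (W.rationalTateModule ℓ)) :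
    (EllipticCurves.rationalTateGaloisRepOf (WeierstrassCurve.geomPoints W) ℓ h).IsUnramifiedAt v :=
  (hW ℓ hℓ h hfin).1

/-- The Frobenius half of `HasTateFrobPolyAt` at a fixed prime `ℓ` with `v ∤ ℓ`. [folklore] -/
theorem _root_.WeierstrassCurve.HasTateFrobPolyAt.hasFrobCharpolyAt {K : Type} [Field K]
    [NumberField K] {W : WeierstrassCurve K} {v : HeightOneSpectrum (𝓞 K)} {a : ℤ}
    (hW : W.HasTateFrobPolyAt v a) (ℓ : ℕ) [Fact ℓ.Prime] (hℓ : (ℓ : 𝓞 K) ∉ v.asIdeal)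
    (h : Continuous fun x : Field.absoluteGaloisGroup K × W.rationalTateModule ℓ =>
      EllipticCurves.rationalTateRepresentation (Field.absoluteGaloisGroup K)
        (WeierstrassCurve.geomPoints W) ℓ x.1 x.2)
    (hfin : Module.Finite ℚ_[ℓ] (W.rationalTateModule ℓ)) :
    (EllipticCurves.rationalTateGaloisRepOf (WeierstrassCurve.geomPoints W) ℓ h).HasFrobCharpolyAt v
      ((frobPoly a v.residueCard).map (Int.castRingHom ℚ_[ℓ])) :=
  (hW ℓ hℓ h hfin).2

/-- The sibling's `IsTateAutomorphic`, restated with `HasTateFrobPolyAt` (definitional).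
[cite: AllenCalegariCaraianiGeeEtAl2023, §7.1] -/
theorem _root_.WeierstrassCurve.isTateAutomorphic_iff {F : Type} [Field F] [NumberField F]
    (W : WeierstrassCurve F) :
    W.IsTateAutomorphic ↔
      ∃ (μ : Measure (AdelicGroupData.gl 2 F).automorphicQuotient)
        (_ : (AdelicGroupData.gl 2 F).IsAutomorphicMeasure μ) (P : CuspidalAutomorphicRepGL 2 F μ)
        (𝔫 : Ideal (𝓞 F)) (_ : 𝔫 ≠ 0),
        ∀ᶠ v : HeightOneSpectrum (𝓞 F) in cofinite,
          ¬ v.asIdeal ∣ 𝔫 ∧ ∃ (ϖ : (v.adicCompletion F)ˣ) (α : Multiset ℂ) (a : ℤ),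
            HasSatakeParameterAt P.1 (principalCongruenceLevel 2 F 𝔫) v ϖ α ∧
            (α.map fun z => (X : ℂ[X]) -
                Polynomial.C (((Real.sqrt (v.residueCard : ℝ) : ℝ) : ℂ) * z)).prod =
              (frobPoly a v.residueCard).map (Int.castRingHom ℂ) ∧
            W.HasTateFrobPolyAt v a :=
  Iff.rfl

end TateFrobPoly

/-! ### Automorphy of `R_E` on the carrier `CuspidalAutomorphicRepData` -/

section CuspidalTateAutomorphic

/-- The Weierstrass curve `W / K` (an elliptic curve `E` over the number field `K`) is
**cuspidal-Tate-automorphic**: the compatible system `R_E` *is automorphic* in the sense of Allen et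
al., §7.1 (*"there is a regular algebraic, cuspidal automorphic representation `π` of `GL_n(𝔸_F)`
… such that if `v ∉ S`, then `π_v` is unramified and `rec(π_v |det|_v^{(1-n)/2})(Frob_v)` has
characteristic polynomial `ı(Q_v(X))`"*), read at all but finitely many places on the carrier
`CuspidalAutomorphicRepData 2 K hK` (`π = W / W'` on cusp forms, `AutomorphicRepsGL`; unitary
Satake normalisation `HasSatakeParamAt`) in the three normalisations of the module docstring:
there are `hK` (the true compactness fact typing the carrier) and cuspidal automorphic
representations `π`, `π_H`, `π_V` of `GL_2(𝔸_K)` with `π` of weight zero (`HasWeightZero`: the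
printed "regular algebraic of weight `0`") and `π_H`, `π_V` L-algebraic (`IsLAlgebraic`; they are
`π ⊗ |det|^{∓1/2}`, Buzzard–Gee 2014 §3.4), such that for all but finitely many finite places `v`
there are an integer `a` and Satake parameters `α`, `β`, `γ` of `π`, `π_H`, `π_V` at `v` with
* `V_ℓ E` unramified at `v` with arithmetic Frobenius polynomial `X² - a X + q_v` for all `ℓ` below
  which `v` does not lie (`HasTateFrobPolyAt W v a`);
* `∏_{z ∈ α} (X - q_v^{1/2} z) = X² - a X + q_v` (the printed condition: the eigenvalues of
  `rec(π_v |det|_v^{-1/2})(Frob_v)` are the `q_v^{1/2} α_j`);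
* `∏_{z ∈ β} (X - z) = X² - a X + q_v` (`rec(π_{H,v})(Frob_v)`, i.e. `β` = eigenvalues of the
  geometric Frobenius on `H¹ = V_ℓ(E)^∨`);
* `∏_{z ∈ γ} (X - z⁻¹) = X² - a X + q_v` (`γ⁻¹` = eigenvalues of the arithmetic Frobenius on
  `V_ℓ E`: Buzzard–Gee's L-normalised dictionary `arithFrobPolyOfSatake ι q_v 1 γ` for `ρ = V_ℓ E`,
  see `IsCuspidalTateAutomorphic.exists_isLAlgebraic_arithFrobPolyOfSatake`).

"For all `v ∉ S_E`" is weakened to "all but finitely many `v`"; like `IsTateAutomorphic` this is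
stated for every Weierstrass curve (a junk notion for singular `W`). Deliberate dot-notation
extension of Mathlib's `WeierstrassCurve` namespace.
[cite: AllenCalegariCaraianiGeeEtAl2023, §7.1 (definition of an automorphic compatible system, for R = R_E)]
[cite: BuzzardGeeLMS2014, Def. 3.1.1 and §3.4] -/
def _root_.WeierstrassCurve.IsCuspidalTateAutomorphic {K : Type} [Field K] [NumberField K]
    (W : WeierstrassCurve K) : Prop :=
  ∃ (hK : isCompact_glFiniteIntegralLevel 2 K) (π πH πV : CuspidalAutomorphicRepData 2 K hK),
    π.1.HasWeightZero ∧ πH.1.IsLAlgebraic ∧ πV.1.IsLAlgebraic ∧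
    ∀ᶠ v : HeightOneSpectrum (𝓞 K) in cofinite, ∃ (a : ℤ) (α β γ : Multiset ℂ),
      W.HasTateFrobPolyAt v a ∧
      (π.1.HasSatakeParamAt v α ∧
        (α.map fun z => (X : ℂ[X]) -
            Polynomial.C (((Real.sqrt (v.residueCard : ℝ) : ℝ) : ℂ) * z)).prod =
          (frobPoly a v.residueCard).map (Int.castRingHom ℂ)) ∧
      (πH.1.HasSatakeParamAt v β ∧
        (β.map fun z => (X : ℂ[X]) - Polynomial.C z).prod =
          (frobPoly a v.residueCard).map (Int.castRingHom ℂ)) ∧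
      (πV.1.HasSatakeParamAt v γ ∧
        (γ.map fun z => (X : ℂ[X]) - Polynomial.C z⁻¹).prod =
          (frobPoly a v.residueCard).map (Int.castRingHom ℂ))

/-- **The Galois half of cuspidal-Tate-automorphy**: at all but finitely many `v`, `V_ℓ E` has an
integral Frobenius polynomial `X² - a X + q_v` (all `ℓ` with `v ∤ ℓ`).
[cite: AllenCalegariCaraianiGeeEtAl2023, §7.1] -/
theorem _root_.WeierstrassCurve.IsCuspidalTateAutomorphic.eventually_hasTateFrobPolyAt {K : Type}
    [Field K] [NumberField K] {W : WeierstrassCurve K} (hW : W.IsCuspidalTateAutomorphic) :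
    ∀ᶠ v : HeightOneSpectrum (𝓞 K) in cofinite, ∃ a : ℤ, W.HasTateFrobPolyAt v a := by
  obtain ⟨hK, π, πH, πV, -, -, -, hev⟩ := hW
  filter_upwards [hev] with v hv
  obtain ⟨a, -, -, -, hGal, -, -, -⟩ := hv
  exact ⟨a, hGal⟩

/-- **Route-ready form for `ρ = V_ℓ E` (Buzzard–Gee's `m = 1` dictionary).** If `W` is
cuspidal-Tate-automorphic then for every prime `ℓ` and `ι : ℚ̄_ℓ ≃+* ℂ` there is an L-algebraic
cuspidal `π` of `GL_2(𝔸_K)` (namely `π_V`) such that at all but finitely many `v`, for some Satake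
parameter `γ` of `π` at `v` and some `a ∈ ℤ`: `∏_j (X - ι⁻¹(γ_j⁻¹)) = X² - a X + q_v` in `ℚ̄_ℓ[X]`
(`arithFrobPolyOfSatake ι q_v 1 γ`, `ReciprocityGLn`) and `V_{ℓ'} E` is unramified at `v` with
arithmetic Frobenius polynomial `X² - a X + q_v` for every `ℓ'` with `v ∤ ℓ'` — the shape of the
summit's `SatakeFrobCompatibleAt ι π ρ v` for the (pending, framed) `ρ = V_ℓ E ⊗ ℚ̄_ℓ`. Proof: map
the identity `∏ (X - γ_j⁻¹) = X² - a X + q_v` along `ι⁻¹` (`map_prod_X_sub_C_inv`,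
`map_map_frobPoly`, `arithFrobPolyOfSatake_one`). [cite: BuzzardGeeLMS2014, Conj. 3.2.1 and Rem. 3.2.5 (normalisation)] -/
theorem _root_.WeierstrassCurve.IsCuspidalTateAutomorphic.exists_isLAlgebraic_arithFrobPolyOfSatake
    {K : Type} [Field K] [NumberField K] {W : WeierstrassCurve K}
    (hW : W.IsCuspidalTateAutomorphic) (ℓ : ℕ) [Fact ℓ.Prime] (ι : PadicAlgCl ℓ ≃+* ℂ) :
    ∃ (hK : isCompact_glFiniteIntegralLevel 2 K) (π : CuspidalAutomorphicRepData 2 K hK),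
      π.1.IsLAlgebraic ∧
      ∀ᶠ v : HeightOneSpectrum (𝓞 K) in cofinite, ∃ (γ : Multiset ℂ) (a : ℤ),
        π.1.HasSatakeParamAt v γ ∧
        arithFrobPolyOfSatake ι v.residueCard 1 γ =
          (frobPoly a v.residueCard).map (Int.castRingHom (PadicAlgCl ℓ)) ∧
        W.HasTateFrobPolyAt v a := by
  obtain ⟨hK, π, πH, πV, -, -, hL, hev⟩ := hW
  refine ⟨hK, πV, hL, ?_⟩
  filter_upwards [hev] with v hv
  obtain ⟨a, -, -, γ, hGal, -, -, hSat, hpoly⟩ := hv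
  refine ⟨γ, a, hSat, ?_, hGal⟩
  have h := congrArg (Polynomial.map (ι.symm : ℂ →+* PadicAlgCl ℓ)) hpoly
  rw [map_prod_X_sub_C_inv, map_map_frobPoly] at h
  rw [arithFrobPolyOfSatake_one]
  simpa using h

/-- **Route-ready form for `ρ = V_ℓ(E)^∨ = H¹` (geometric normalisation).** If `W` is
cuspidal-Tate-automorphic then for every prime `ℓ` and `ι : ℚ̄_ℓ ≃+* ℂ` there is an L-algebraic
cuspidal `π` of `GL_2(𝔸_K)` (namely `π_H`) such that at all but finitely many `v`, for some Satake
parameter `β` of `π` at `v` and some `a ∈ ℤ`: `∏_j (X - ι⁻¹(β_j)) = X² - a X + q_v` in `ℚ̄_ℓ[X]`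
(the `ι⁻¹(β_j)` are the geometric Frobenius eigenvalues on `H¹`, equivalently the arithmetic ones
on `V_ℓ E`) and `HasTateFrobPolyAt W v a`. [cite: AllenCalegariCaraianiGeeEtAl2023, §7.1] -/
theorem _root_.WeierstrassCurve.IsCuspidalTateAutomorphic.exists_isLAlgebraic_prod_X_sub_C
    {K : Type} [Field K] [NumberField K] {W : WeierstrassCurve K}
    (hW : W.IsCuspidalTateAutomorphic) (ℓ : ℕ) [Fact ℓ.Prime] (ι : PadicAlgCl ℓ ≃+* ℂ) :
    ∃ (hK : isCompact_glFiniteIntegralLevel 2 K) (π : CuspidalAutomorphicRepData 2 K hK),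
      π.1.IsLAlgebraic ∧
      ∀ᶠ v : HeightOneSpectrum (𝓞 K) in cofinite, ∃ (β : Multiset ℂ) (a : ℤ),
        π.1.HasSatakeParamAt v β ∧
        (β.map fun z => (X : (PadicAlgCl ℓ)[X]) - Polynomial.C (ι.symm z)).prod =
          (frobPoly a v.residueCard).map (Int.castRingHom (PadicAlgCl ℓ)) ∧
        W.HasTateFrobPolyAt v a := by
  obtain ⟨hK, π, πH, πV, -, hL, -, hev⟩ := hW
  refine ⟨hK, πH, hL, ?_⟩
  filter_upwards [hev] with v hv
  obtain ⟨a, -, β, -, hGal, -, ⟨hSat, hpoly⟩, -⟩ := hv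
  refine ⟨β, a, hSat, ?_, hGal⟩
  have h := congrArg (Polynomial.map (ι.symm : ℂ →+* PadicAlgCl ℓ)) hpoly
  rw [map_prod_X_sub_C, map_map_frobPoly] at h
  simpa using h

/-- The printed (unitary, weight-zero) reading alone: a weight-zero cuspidal `π` with
`∏ (X - q_v^{1/2} α_j) = X² - a X + q_v` and `HasTateFrobPolyAt W v a` at almost all `v` — the
clause of `potentiallyModular_ellipticCurve_CM` (`ReciprocityGLn`) with the full Frobenius
polynomial in place of its trace. [cite: AllenCalegariCaraianiGeeEtAl2023, §7.1] -/
theorem _root_.WeierstrassCurve.IsCuspidalTateAutomorphic.exists_hasWeightZero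
    {K : Type} [Field K] [NumberField K] {W : WeierstrassCurve K}
    (hW : W.IsCuspidalTateAutomorphic) :
    ∃ (hK : isCompact_glFiniteIntegralLevel 2 K) (π : CuspidalAutomorphicRepData 2 K hK),
      π.1.HasWeightZero ∧
      ∀ᶠ v : HeightOneSpectrum (𝓞 K) in cofinite, ∃ (α : Multiset ℂ) (a : ℤ),
        π.1.HasSatakeParamAt v α ∧
        (α.map fun z => (X : ℂ[X]) -
            Polynomial.C (((Real.sqrt (v.residueCard : ℝ) : ℝ) : ℂ) * z)).prod =
          (frobPoly a v.residueCard).map (Int.castRingHom ℂ) ∧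
        W.HasTateFrobPolyAt v a := by
  obtain ⟨hK, π, πH, πV, h0, -, -, hev⟩ := hW
  refine ⟨hK, π, h0, ?_⟩
  filter_upwards [hev] with v hv
  obtain ⟨a, α, -, -, hGal, ⟨hSat, hpoly⟩, -, -⟩ := hv
  exact ⟨α, a, hSat, hpoly, hGal⟩

end CuspidalTateAutomorphic

/-! ### lang.S28, strong form: potential automorphy with soluble descent -/

section SolubleDescent

/-- **lang.S28, strong form with soluble descent** (Allen–Calegari–Caraiani–Gee–Helm–Le Hung–
Newton–Scholze–Taylor–Thorne, *Potential automorphy over CM fields*, Ann. of Math. 197 (2023),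
Cor. 7.1.12 for `m = 1` and `R = R_E`, combined with their Prop. 6.5.13 (2)). Printed Cor. 7.1.12:
*Suppose that `F` is a CM field and that `R = (M, S, {Q_v(X)}, {r_λ}, {{0,1}})` is a strongly
irreducible rank `2` very weakly compatible system of `l`-adic representations of `G_F`. If `m` is a
non-negative integer, then there exists a finite Galois CM extension `F'/F` such that the weakly
compatible system `Symm^m R|_{G_{F'}}` is automorphic.* Printed Prop. 6.5.13 (2): *Let `F` be an
imaginary CM or totally real number field, and let `E/F` be a finite Galois extension such that
`Gal(E/F)` is soluble and `E` is also imaginary CM or totally real. Let `ρ : G_F → GL_n(ℚ̄_p)` be a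
continuous representation such that `ρ|_{G_E}` is irreducible. Suppose that there exists a
cuspidal, regular algebraic automorphic representation `π` of `GL_n(𝔸_E)` of weight `λ` such that
`ρ|_{G_E} ≅ r_ι(π)`. Then … there exists a cuspidal, regular algebraic automorphic representation
`π_F` of `GL_n(𝔸_F)` of weight `λ_F` such that `ρ ≅ r_ι(π_F)`* (proof: cyclic layers of prime
degree, strong multiplicity one, Arthur–Clozel Ch. 3 Thm. 4.2 (d) and Thm. 5.1, Chebotarev, and the
Galois representations `r_ι` of Harris–Lan–Taylor–Thorne Thm. A to select the descended twist).

For an elliptic curve `E` without geometric CM (`¬ W.HasCM`, prelude `Isogeny`) over the CM field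
`F`, `R_E = (ℚ, S_E, {X² - a_v X + q_v}, {V_l(E)^∨}, {{0,1}})` is a strongly irreducible rank-2 very
weakly compatible system (as the source uses for Thm. 1.0.1 and Cor. 7.1.14; Serre 1972 §4.4 /
Faltings 1983 Satz 4 for irreducibility over every number field). Cor. 7.1.12 gives a finite Galois
CM `F'/F` over which `R_E` is automorphic; for every intermediate field `F ⊆ K ⊆ F'` with
`Gal(F'/K)` soluble, `K` is again CM, `F'/K` is soluble Galois and `V_p(E)^∨|_{G_{F'}}` is
irreducible and `≅ r_ι(π')` (HLTT Thm. A with Chebotarev and Brauer–Nesbitt), so Prop. 6.5.13 (2)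
over `K` yields a weight-`0` cuspidal `π_K` of `GL_2(𝔸_K)` with `r_ι(π_K) ≅ V_p(E)^∨|_{G_K}`, i.e.
`R_E|_{G_K} = R_{E ×_F K}` is automorphic at all but finitely many places (module docstring,
"The strong form"). The conclusion is read on both carriers of the tree: the sibling's
`IsTateAutomorphic` (`L²` cuspidal spectrum, Borel–Jacquet 4.4–4.6 dictionary, as in the sibling)
and `IsCuspidalTateAutomorphic` (this file). Hence: **for every elliptic curve `E` without
geometric CM over a CM number field `F` there is a finite extension `F'/F`, Galois over `F`, with
`F'` a CM field, such that for every number field `K` with `F ⊆ K ⊆ F'` (`IsScalarTower F K F'`)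
and `Gal(F'/K)` soluble (`IsSolvable (F' ≃ₐ[K] F')`), `E ×_F K` is Tate-automorphic and
cuspidal-Tate-automorphic.** `K = F'` recovers the Galois form of lang.S28
(`exists_isCMField_isTateAutomorphic_of_forall_isSolvable`). Intermediate fields are typed as in
the route `AnalyticDescent` (`DescentGL2`). Named fact (D-0014).
[cite: AllenCalegariCaraianiGeeEtAl2023, Cor. 7.1.12 (m = 1, R = R_E) and Prop. 6.5.13 (2), with §7.1]
[cite: ArthurClozelAMS120, Ch. 3, Thm. 4.2 (d) and Thm. 5.1]
[cite: HarrisLanTaylorThorneRMS2016, Thm. A]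
[cite: SerreInventiones1972, §4.4] -/
def exists_isCMField_forall_isSolvable_isTateAutomorphic : Prop :=
  ∀ {F : Type} [Field F] [NumberField F] [IsCMField F] (W : WeierstrassCurve F) [W.IsElliptic]
    (_hW : ¬ W.HasCM),
    ∃ (F' : Type) (_ : Field F') (_ : NumberField F') (_ : Algebra F F'),
      IsCMField F' ∧ IsGalois F F' ∧
      ∀ (K : Type) [Field K] [NumberField K] [Algebra F K] [Algebra K F'] [IsScalarTower F K F'],
        IsSolvable (F' ≃ₐ[K] F') →
          (W.baseChange K).IsTateAutomorphic ∧ (W.baseChange K).IsCuspidalTateAutomorphic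

/-- **The strong form implies lang.S28 in Galois form.** Taking `K = F'` in
`exists_isCMField_forall_isSolvable_isTateAutomorphic` (`Gal(F'/F')` is trivial, hence soluble:
Mathlib `AlgEquiv.subsingleton_left`, `isSolvable_of_subsingleton`) gives the Galois form of
lang.S28 — *for every elliptic curve `E` without geometric CM over a CM number field `F` there is
a finite extension `F'/F`, Galois over `F`, with `F'` a CM field, such that `E ×_F F'` is
Tate-automorphic* (the statement of the former named fact `exists_isCMField_isTateAutomorphic` of
`Sweep1PotentialModularity`, merged back into its parent obligation on 2026-08-15; the theorem
keeps its name) — and thence `exists_isCMField_isModular` of `Sweep1`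
(`exists_isCMField_isModular_of_exists_isCMField_isTateAutomorphic`,
`Sweep1PotentialModularityReductionProofs`).
[cite: AllenCalegariCaraianiGeeEtAl2023, Cor. 7.1.12 (m = 1, R = R_E)] -/
theorem exists_isCMField_isTateAutomorphic_of_forall_isSolvable
    (h : exists_isCMField_forall_isSolvable_isTateAutomorphic) :
    ∀ {F : Type} [Field F] [NumberField F] [IsCMField F] (W : WeierstrassCurve F) [W.IsElliptic]
      (_hW : ¬ W.HasCM),
      ∃ (F' : Type) (_ : Field F') (_ : NumberField F') (_ : Algebra F F'),
        IsCMField F' ∧ IsGalois F F' ∧ (W.baseChange F').IsTateAutomorphic := by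
  intro F _ _ _ W _ hW
  obtain ⟨F', hF', hNF', hAlg, hCM, hGal, hsol⟩ := h W hW
  refine ⟨F', hF', hNF', hAlg, hCM, hGal, ?_⟩
  letI : Algebra F' F' := Algebra.id F'
  have hs : IsSolvable (F' ≃ₐ[F'] F') := inferInstance
  exact (hsol F' hs).1

/-- The strong form also yields, over every soluble-index intermediate field, the Galois half:
`V_ℓ(E ×_F K)` has integral Frobenius polynomials at almost all places.
[cite: AllenCalegariCaraianiGeeEtAl2023, §7.1] -/
theorem exists_isCMField_forall_isSolvable_eventually_hasTateFrobPolyAt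
    (h : exists_isCMField_forall_isSolvable_isTateAutomorphic)
    {F : Type} [Field F] [NumberField F] [IsCMField F] (W : WeierstrassCurve F) [W.IsElliptic]
    (hW : ¬ W.HasCM) :
    ∃ (F' : Type) (_ : Field F') (_ : NumberField F') (_ : Algebra F F'),
      IsCMField F' ∧ IsGalois F F' ∧
      ∀ (K : Type) [Field K] [NumberField K] [Algebra F K] [Algebra K F'] [IsScalarTower F K F'],
        IsSolvable (F' ≃ₐ[K] F') →
          ∀ᶠ v : HeightOneSpectrum (𝓞 K) in cofinite, ∃ a : ℤ, (W.baseChange K).HasTateFrobPolyAt v a := by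
  obtain ⟨F', hF', hNF', hAlg, hCM, hGal, hsol⟩ := h W hW
  refine ⟨F', hF', hNF', hAlg, hCM, hGal, fun K _ _ _ _ _ hs => ?_⟩
  exact (hsol K hs).2.eventually_hasTateFrobPolyAt

end SolubleDescent

end Literature.NumberTheory.Automorphic
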